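import Mathlib
import HarnessLib

/-!
# Route `KLProgramme` — crux K3 ENGINE (stmt-HubbardSuperconductivity-20437) stub (b) conj. 2 «(c-D)² FAMILY TELESCOPE», brick (D5n): the CLOSED
# DEFECT AMPLITUDE AT THE REFERENCE SCALE is `≤ 𝒜·(G₀/x₀²)/(cΛ²)`, `𝒜` scale-free

Cell `gate-hubbard-kl`, seat hubbard-kl-k3c3-p2 (g11); F1-DESIGN §10.  The covariance piece (`…EngineSliceCovPieceTel`) bounds its rows by
`8·9·(D_w x₀)·√Ŵ(x₀)·√N̄·A₀^♯(x₀)` with `A₀^♯(x₀) = c₀X₀ + T_t/(4/(s₀·2M))³ + Σ_blocks c₀[…]/(4/(rate·L))^{3,2}` (rates `ρ/x₀`, `ρ₃/x₀`, `N_r = 2`).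
Given the polynomial sizes of `…EngineSliceCovAmpAtoms` (`X_k ≤ cPx₀^k𝔛_k/Λ²`, `T_t ≤ (2π/β)³P𝔗/(cΛ⁵)`, `P = G₀/x₀²`), the amplitude slots
`L·A_{e1} ≤ 𝔞_{e1}/Λ_m`, `L²·A_{e2} ≤ 𝔞_{e2}/Λ_m²`, … (`rateAmps_pack'` + `covAe_le`), the time rate `s₀·2M ≤ 2σΛβ`, and the reference-scale
inequalities `1 ≤ Λ_m x₀`, `(κ_A + κ_B)/(Λ_m³x₀³) ≤ κ_s`:

* `covBlock3_le`, `covBlock2_le` — one cubic / quadratic rate block `≤ (P/(cΛ²))·(r³/64)·𝔅₃`, `(P/(cΛ²))·(r²/16)·𝔅₂`;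
* **`covDefect_ampRef_le`** — `A₀^♯(x₀) ≤ (P/(cΛ²))·𝒜`, `𝒜 = K1 + π³σ³𝔗 + (ρ³/64)(𝔅_e + 𝔅_n + 𝔅_v) + (ρ₃²/16)𝔅₂`.

Pure real-arithmetic bookkeeping; no definitions, no sorry. [folklore]
-/

noncomputable section

namespace Summit.HubbardSuperconductivity.HubbardSuperconductivity.Theorems.TorusFourierL2

set_option linter.dupNamespace false -- summit = problem name (single-conjunct summit), D-0017

open Real

/-- **One cubic rate block.** [folklore] -/
theorem covBlock3_le {c Λ lam L x₀ r P θ ℓ a1 a2 𝔞1 𝔞2 X₀ X₁ X₂ X₃ 𝔛₁ 𝔛₂ 𝔛₃ K1 κ κs : ℝ}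
    (hc : 0 < c) (hΛ : 0 < Λ) (hlam : 0 < lam) (hL : 0 < L) (hx₀ : 1 ≤ x₀) (hlx : 1 ≤ lam * x₀) (hr : 0 ≤ r) (hP : 0 ≤ P) (hθ : 0 ≤ θ)
    (hℓ : ℓ * L = θ) (ha1 : 0 ≤ a1) (ha2 : 0 ≤ a2) (h𝔞1 : L * a1 ≤ 𝔞1 / lam) (h𝔞2 : L ^ 2 * a2 ≤ 𝔞2 / lam ^ 2)
    (hX₁0 : 0 ≤ X₁) (hX₂0 : 0 ≤ X₂) (h𝔛₁ : 0 ≤ 𝔛₁) (h𝔛₂ : 0 ≤ 𝔛₂) (hK1 : 0 ≤ K1)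
    (hX₀ : X₀ = c * P * K1 / Λ ^ 2) (hX₁ : X₁ ≤ c * P * x₀ * 𝔛₁ / Λ ^ 2) (hX₂ : X₂ ≤ c * P * x₀ ^ 2 * 𝔛₂ / Λ ^ 2)
    (hX₃ : X₃ ≤ c * P * x₀ ^ 3 * 𝔛₃ / Λ ^ 2) (hκ : κ / (lam ^ 3 * x₀ ^ 3) ≤ κs) :
    (1 / c) ^ 2 * ((Real.sqrt 2 * ℓ) ^ 3 * X₃ + 3 * (a1 * ((Real.sqrt 2 * ℓ) ^ 2 * X₂)) + 3 * (a2 * ((Real.sqrt 2 * ℓ) * X₁)) + κ * ℓ ^ 3 / lam ^ 3 * X₀) /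
        (4 / (r / x₀ * L)) ^ 3 ≤
      P / (c * Λ ^ 2) * (r ^ 3 / 64 * ((Real.sqrt 2 * θ) ^ 3 * 𝔛₃ + 3 * 𝔞1 * (2 * θ ^ 2) * 𝔛₂ + 3 * 𝔞2 * (Real.sqrt 2 * θ) * 𝔛₁ + κs * θ ^ 3 * K1)) := by
  have hx₀0 : 0 < x₀ := lt_of_lt_of_le one_pos hx₀
  have hs2 : 0 ≤ Real.sqrt 2 := Real.sqrt_nonneg 2
  have hs2sq : Real.sqrt 2 ^ 2 = 2 := Real.sq_sqrt (by norm_num)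
  have hℓe : ℓ = θ / L := by rw [← hℓ]; field_simp
  have hℓ0 : 0 ≤ ℓ := by rw [hℓe]; positivity
  have h𝔞10 : 0 ≤ 𝔞1 := le_trans (by positivity) ((le_div_iff₀ hlam).1 ((mul_nonneg hL.le ha1).trans h𝔞1))
  have h𝔞20 : 0 ≤ 𝔞2 := le_trans (by positivity) ((le_div_iff₀ (by positivity)).1 ((mul_nonneg (sq_nonneg L) ha2).trans h𝔞2))
  -- rewrite the rate factor and distribute `L³`
  have e1 : (1 / c) ^ 2 * ((Real.sqrt 2 * ℓ) ^ 3 * X₃ + 3 * (a1 * ((Real.sqrt 2 * ℓ) ^ 2 * X₂)) + 3 * (a2 * ((Real.sqrt 2 * ℓ) * X₁)) +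
        κ * ℓ ^ 3 / lam ^ 3 * X₀) / (4 / (r / x₀ * L)) ^ 3 =
      (1 / c) ^ 2 * (r ^ 3 / 64) * (1 / x₀ ^ 3) *
        ((Real.sqrt 2 * θ) ^ 3 * X₃ + 3 * ((L * a1) * (2 * θ ^ 2 * X₂)) + 3 * ((L ^ 2 * a2) * ((Real.sqrt 2 * θ) * X₁)) + κ * θ ^ 3 / lam ^ 3 * X₀) := by
    rw [show (Real.sqrt 2 * ℓ) ^ 2 = 2 * ℓ ^ 2 by rw [mul_pow, hs2sq], hℓe]; field_simp; ring
  rw [e1]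
  -- the bracket with the amplitude slots inserted
  have hbr : (Real.sqrt 2 * θ) ^ 3 * X₃ + 3 * ((L * a1) * (2 * θ ^ 2 * X₂)) + 3 * ((L ^ 2 * a2) * ((Real.sqrt 2 * θ) * X₁)) + κ * θ ^ 3 / lam ^ 3 * X₀ ≤
      (Real.sqrt 2 * θ) ^ 3 * (c * P * x₀ ^ 3 * 𝔛₃ / Λ ^ 2) + 3 * ((𝔞1 / lam) * (2 * θ ^ 2 * (c * P * x₀ ^ 2 * 𝔛₂ / Λ ^ 2))) +
        3 * ((𝔞2 / lam ^ 2) * ((Real.sqrt 2 * θ) * (c * P * x₀ * 𝔛₁ / Λ ^ 2))) + κ * θ ^ 3 / lam ^ 3 * (c * P * K1 / Λ ^ 2) := by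
    rw [← hX₀]
    have u1 : (Real.sqrt 2 * θ) ^ 3 * X₃ ≤ (Real.sqrt 2 * θ) ^ 3 * (c * P * x₀ ^ 3 * 𝔛₃ / Λ ^ 2) := mul_le_mul_of_nonneg_left hX₃ (by positivity)
    have u2 : (L * a1) * (2 * θ ^ 2 * X₂) ≤ (𝔞1 / lam) * (2 * θ ^ 2 * (c * P * x₀ ^ 2 * 𝔛₂ / Λ ^ 2)) :=
      mul_le_mul h𝔞1 (mul_le_mul_of_nonneg_left hX₂ (by positivity)) (by positivity) (by positivity)
    have u3 : (L ^ 2 * a2) * ((Real.sqrt 2 * θ) * X₁) ≤ (𝔞2 / lam ^ 2) * ((Real.sqrt 2 * θ) * (c * P * x₀ * 𝔛₁ / Λ ^ 2)) :=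
      mul_le_mul h𝔞2 (mul_le_mul_of_nonneg_left hX₁ (by positivity)) (by positivity) (by positivity)
    linarith [u1, u2, u3]
  -- the reference-scale inequalities `1/(Λ_m x₀) ≤ 1`, `1/(Λ_m² x₀²) ≤ 1`, `κ/(Λ_m³x₀³) ≤ κ_s`
  have hlx0 : 0 < lam * x₀ := by positivity
  have i1 : 1 / (lam * x₀) ≤ 1 := by rw [div_le_one hlx0]; exact hlx
  have i2 : 1 / (lam * x₀) ^ 2 ≤ 1 := by rw [div_le_one (by positivity)]; exact one_le_pow₀ hlx
  have key : (1 / c) ^ 2 * (r ^ 3 / 64) * (1 / x₀ ^ 3) *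
      ((Real.sqrt 2 * θ) ^ 3 * (c * P * x₀ ^ 3 * 𝔛₃ / Λ ^ 2) + 3 * ((𝔞1 / lam) * (2 * θ ^ 2 * (c * P * x₀ ^ 2 * 𝔛₂ / Λ ^ 2))) +
        3 * ((𝔞2 / lam ^ 2) * ((Real.sqrt 2 * θ) * (c * P * x₀ * 𝔛₁ / Λ ^ 2))) + κ * θ ^ 3 / lam ^ 3 * (c * P * K1 / Λ ^ 2)) =
      P / (c * Λ ^ 2) * (r ^ 3 / 64 * ((Real.sqrt 2 * θ) ^ 3 * 𝔛₃ + 3 * 𝔞1 * (2 * θ ^ 2) * 𝔛₂ * (1 / (lam * x₀)) +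
        3 * 𝔞2 * (Real.sqrt 2 * θ) * 𝔛₁ * (1 / (lam * x₀) ^ 2) + (κ / (lam ^ 3 * x₀ ^ 3)) * θ ^ 3 * K1)) := by
    field_simp
  have hfin : (Real.sqrt 2 * θ) ^ 3 * 𝔛₃ + 3 * 𝔞1 * (2 * θ ^ 2) * 𝔛₂ * (1 / (lam * x₀)) +
        3 * 𝔞2 * (Real.sqrt 2 * θ) * 𝔛₁ * (1 / (lam * x₀) ^ 2) + (κ / (lam ^ 3 * x₀ ^ 3)) * θ ^ 3 * K1 ≤
      (Real.sqrt 2 * θ) ^ 3 * 𝔛₃ + 3 * 𝔞1 * (2 * θ ^ 2) * 𝔛₂ + 3 * 𝔞2 * (Real.sqrt 2 * θ) * 𝔛₁ + κs * θ ^ 3 * K1 := by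
    have v1 : 3 * 𝔞1 * (2 * θ ^ 2) * 𝔛₂ * (1 / (lam * x₀)) ≤ 3 * 𝔞1 * (2 * θ ^ 2) * 𝔛₂ := mul_le_of_le_one_right (by positivity) i1
    have v2 : 3 * 𝔞2 * (Real.sqrt 2 * θ) * 𝔛₁ * (1 / (lam * x₀) ^ 2) ≤ 3 * 𝔞2 * (Real.sqrt 2 * θ) * 𝔛₁ := mul_le_of_le_one_right (by positivity) i2
    have v3 : (κ / (lam ^ 3 * x₀ ^ 3)) * θ ^ 3 * K1 ≤ κs * θ ^ 3 * K1 := by gcongr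
    linarith [v1, v2, v3]
  calc _ ≤ (1 / c) ^ 2 * (r ^ 3 / 64) * (1 / x₀ ^ 3) *
        ((Real.sqrt 2 * θ) ^ 3 * (c * P * x₀ ^ 3 * 𝔛₃ / Λ ^ 2) + 3 * ((𝔞1 / lam) * (2 * θ ^ 2 * (c * P * x₀ ^ 2 * 𝔛₂ / Λ ^ 2))) +
          3 * ((𝔞2 / lam ^ 2) * ((Real.sqrt 2 * θ) * (c * P * x₀ * 𝔛₁ / Λ ^ 2))) + κ * θ ^ 3 / lam ^ 3 * (c * P * K1 / Λ ^ 2)) :=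
        mul_le_mul_of_nonneg_left hbr (by positivity)
    _ = _ := key
    _ ≤ _ := mul_le_mul_of_nonneg_left (mul_le_mul_of_nonneg_left hfin (by positivity)) (by positivity)

/-- **The quadratic rate block.** [folklore] -/
theorem covBlock2_le {c Λ lam L x₀ r P θ ℓ a1 a2 𝔞1 𝔞2 X₀ X₁ X₂ 𝔛₁ 𝔛₂ K1 : ℝ}
    (hc : 0 < c) (hΛ : 0 < Λ) (hlam : 0 < lam) (hL : 0 < L) (hx₀ : 1 ≤ x₀) (hlx : 1 ≤ lam * x₀) (hP : 0 ≤ P) (hθ : 0 ≤ θ)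
    (hℓ : ℓ * L = θ) (ha1 : 0 ≤ a1) (ha2 : 0 ≤ a2) (h𝔞1 : L * a1 ≤ 𝔞1 / lam) (h𝔞2 : L ^ 2 * a2 ≤ 𝔞2 / lam ^ 2)
    (hX₀0 : 0 ≤ X₀) (hX₁0 : 0 ≤ X₁) (h𝔛₁ : 0 ≤ 𝔛₁) (hK1 : 0 ≤ K1)
    (hX₀ : X₀ = c * P * K1 / Λ ^ 2) (hX₁ : X₁ ≤ c * P * x₀ * 𝔛₁ / Λ ^ 2) (hX₂ : X₂ ≤ c * P * x₀ ^ 2 * 𝔛₂ / Λ ^ 2) :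
    (1 / c) ^ 2 * ((Real.sqrt 2 * ℓ) ^ 2 * X₂ + 2 * (a1 * ((Real.sqrt 2 * ℓ) * X₁)) + a2 * X₀) / (4 / (r / x₀ * L)) ^ 2 ≤
      P / (c * Λ ^ 2) * (r ^ 2 / 16 * (2 * θ ^ 2 * 𝔛₂ + 2 * 𝔞1 * (Real.sqrt 2 * θ) * 𝔛₁ + 𝔞2 * K1)) := by
  have hx₀0 : 0 < x₀ := lt_of_lt_of_le one_pos hx₀
  have hs2 : 0 ≤ Real.sqrt 2 := Real.sqrt_nonneg 2
  have hs2sq : Real.sqrt 2 ^ 2 = 2 := Real.sq_sqrt (by norm_num)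
  have hℓe : ℓ = θ / L := by rw [← hℓ]; field_simp
  have h𝔞10 : 0 ≤ 𝔞1 := le_trans (by positivity) ((le_div_iff₀ hlam).1 ((mul_nonneg hL.le ha1).trans h𝔞1))
  have h𝔞20 : 0 ≤ 𝔞2 := le_trans (by positivity) ((le_div_iff₀ (by positivity)).1 ((mul_nonneg (sq_nonneg L) ha2).trans h𝔞2))
  have e1 : (1 / c) ^ 2 * ((Real.sqrt 2 * ℓ) ^ 2 * X₂ + 2 * (a1 * ((Real.sqrt 2 * ℓ) * X₁)) + a2 * X₀) / (4 / (r / x₀ * L)) ^ 2 =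
      (1 / c) ^ 2 * (r ^ 2 / 16) * (1 / x₀ ^ 2) * (2 * θ ^ 2 * X₂ + 2 * ((L * a1) * ((Real.sqrt 2 * θ) * X₁)) + (L ^ 2 * a2) * X₀) := by
    rw [show (Real.sqrt 2 * ℓ) ^ 2 = 2 * ℓ ^ 2 by rw [mul_pow, hs2sq], hℓe]; field_simp; ring
  rw [e1]
  have hbr : 2 * θ ^ 2 * X₂ + 2 * ((L * a1) * ((Real.sqrt 2 * θ) * X₁)) + (L ^ 2 * a2) * X₀ ≤
      2 * θ ^ 2 * (c * P * x₀ ^ 2 * 𝔛₂ / Λ ^ 2) + 2 * ((𝔞1 / lam) * ((Real.sqrt 2 * θ) * (c * P * x₀ * 𝔛₁ / Λ ^ 2))) + (𝔞2 / lam ^ 2) * (c * P * K1 / Λ ^ 2) := by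
    rw [← hX₀]
    have u1 : 2 * θ ^ 2 * X₂ ≤ 2 * θ ^ 2 * (c * P * x₀ ^ 2 * 𝔛₂ / Λ ^ 2) := mul_le_mul_of_nonneg_left hX₂ (by positivity)
    have u2 : (L * a1) * ((Real.sqrt 2 * θ) * X₁) ≤ (𝔞1 / lam) * ((Real.sqrt 2 * θ) * (c * P * x₀ * 𝔛₁ / Λ ^ 2)) :=
      mul_le_mul h𝔞1 (mul_le_mul_of_nonneg_left hX₁ (by positivity)) (by positivity) (by positivity)
    have u3 : (L ^ 2 * a2) * X₀ ≤ (𝔞2 / lam ^ 2) * X₀ := mul_le_mul_of_nonneg_right h𝔞2 hX₀0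
    linarith [u1, u2, u3]
  have hlx0 : 0 < lam * x₀ := by positivity
  have i1 : 1 / (lam * x₀) ≤ 1 := by rw [div_le_one hlx0]; exact hlx
  have i2 : 1 / (lam * x₀) ^ 2 ≤ 1 := by rw [div_le_one (by positivity)]; exact one_le_pow₀ hlx
  have key : (1 / c) ^ 2 * (r ^ 2 / 16) * (1 / x₀ ^ 2) *
      (2 * θ ^ 2 * (c * P * x₀ ^ 2 * 𝔛₂ / Λ ^ 2) + 2 * ((𝔞1 / lam) * ((Real.sqrt 2 * θ) * (c * P * x₀ * 𝔛₁ / Λ ^ 2))) + (𝔞2 / lam ^ 2) * (c * P * K1 / Λ ^ 2)) =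
      P / (c * Λ ^ 2) * (r ^ 2 / 16 * (2 * θ ^ 2 * 𝔛₂ + 2 * 𝔞1 * (Real.sqrt 2 * θ) * 𝔛₁ * (1 / (lam * x₀)) + 𝔞2 * K1 * (1 / (lam * x₀) ^ 2))) := by
    field_simp
  have hfin : 2 * θ ^ 2 * 𝔛₂ + 2 * 𝔞1 * (Real.sqrt 2 * θ) * 𝔛₁ * (1 / (lam * x₀)) + 𝔞2 * K1 * (1 / (lam * x₀) ^ 2) ≤
      2 * θ ^ 2 * 𝔛₂ + 2 * 𝔞1 * (Real.sqrt 2 * θ) * 𝔛₁ + 𝔞2 * K1 := by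
    have v1 : 2 * 𝔞1 * (Real.sqrt 2 * θ) * 𝔛₁ * (1 / (lam * x₀)) ≤ 2 * 𝔞1 * (Real.sqrt 2 * θ) * 𝔛₁ := mul_le_of_le_one_right (by positivity) i1
    have v2 : 𝔞2 * K1 * (1 / (lam * x₀) ^ 2) ≤ 𝔞2 * K1 := mul_le_of_le_one_right (by positivity) i2
    linarith [v1, v2]
  calc _ ≤ (1 / c) ^ 2 * (r ^ 2 / 16) * (1 / x₀ ^ 2) *
        (2 * θ ^ 2 * (c * P * x₀ ^ 2 * 𝔛₂ / Λ ^ 2) + 2 * ((𝔞1 / lam) * ((Real.sqrt 2 * θ) * (c * P * x₀ * 𝔛₁ / Λ ^ 2))) + (𝔞2 / lam ^ 2) * (c * P * K1 / Λ ^ 2)) :=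
        mul_le_mul_of_nonneg_left hbr (by positivity)
    _ = _ := key
    _ ≤ _ := mul_le_mul_of_nonneg_left (mul_le_mul_of_nonneg_left hfin (by positivity)) (by positivity)

set_option maxHeartbeats 1600000 in
/-- **The closed defect amplitude at the reference scale is `≤ (P/(cΛ²))·𝒜`** (see the module docstring). [folklore] -/
theorem covDefect_ampRef_le {c Λ lam L β x₀ ρ ρ₃ σ s₀ P2M Nr P ℓ₁ ℓ Ae1 Ae2 An1 An2 Av1 Av2 𝔞e1 𝔞e2 𝔞n1 𝔞n2 𝔞v1 𝔞v2
    X₀s X₁s X₂s X₃s Tts 𝔛₁ 𝔛₂ 𝔛₃ 𝔗 K1 κA κB κs AΔs : ℝ}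
    (hc : 0 < c) (hΛ : 0 < Λ) (hlam : 0 < lam) (hL : 0 < L) (hβ : 0 < β) (hx₀ : 1 ≤ x₀) (hlx : 1 ≤ lam * x₀) (hρ : 0 ≤ ρ)
    (hs₀ : 0 < s₀) (hP2M : 0 < P2M) (hsM : s₀ * P2M ≤ 2 * σ * Λ * β) (hNr : Nr = 2) (hP : 0 ≤ P)
    (hℓ₁ : ℓ₁ = 2 * π / L) (hℓ : ℓ = 2 * π / L * (Nr + 1 / 2))
    (hAe10 : 0 ≤ Ae1) (hAe20 : 0 ≤ Ae2) (hAn10 : 0 ≤ An1) (hAn20 : 0 ≤ An2) (hAv10 : 0 ≤ Av1) (hAv20 : 0 ≤ Av2)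
    (h𝔞e1 : L * Ae1 ≤ 𝔞e1 / lam) (h𝔞e2 : L ^ 2 * Ae2 ≤ 𝔞e2 / lam ^ 2) (h𝔞n1 : L * An1 ≤ 𝔞n1 / lam) (h𝔞n2 : L ^ 2 * An2 ≤ 𝔞n2 / lam ^ 2)
    (h𝔞v1 : L * Av1 ≤ 𝔞v1 / lam) (h𝔞v2 : L ^ 2 * Av2 ≤ 𝔞v2 / lam ^ 2)
    (hX₀0 : 0 ≤ X₀s) (hX₁0 : 0 ≤ X₁s) (hX₂0 : 0 ≤ X₂s) (h𝔛₁ : 0 ≤ 𝔛₁) (h𝔛₂ : 0 ≤ 𝔛₂) (hK1 : 0 ≤ K1) (h𝔗 : 0 ≤ 𝔗)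
    (hX₀ : X₀s = c * P * K1 / Λ ^ 2) (hX₁ : X₁s ≤ c * P * x₀ * 𝔛₁ / Λ ^ 2) (hX₂ : X₂s ≤ c * P * x₀ ^ 2 * 𝔛₂ / Λ ^ 2)
    (hX₃ : X₃s ≤ c * P * x₀ ^ 3 * 𝔛₃ / Λ ^ 2) (hTts : Tts ≤ (2 * π / β) ^ 3 * P * 𝔗 / (c * Λ ^ 5))
    (hκ : (κA + κB) / (lam ^ 3 * x₀ ^ 3) ≤ κs)
    (hAΔs : AΔs = (1 / c) ^ 2 * X₀s + Tts / (4 / (s₀ * P2M)) ^ 3 +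
      (1 / c) ^ 2 * ((Real.sqrt 2 * ℓ₁) ^ 3 * X₃s + 3 * (Ae1 * ((Real.sqrt 2 * ℓ₁) ^ 2 * X₂s)) +
        3 * (Ae2 * ((Real.sqrt 2 * ℓ₁) * X₁s)) + (κA + κB) * ℓ₁ ^ 3 / lam ^ 3 * X₀s) / (4 / (ρ / x₀ * L)) ^ 3 +
      (1 / c) ^ 2 * ((Real.sqrt 2 * ℓ) ^ 3 * X₃s + 3 * (An1 * ((Real.sqrt 2 * ℓ) ^ 2 * X₂s)) +
        3 * (An2 * ((Real.sqrt 2 * ℓ) * X₁s)) + (κA + κB) * ℓ ^ 3 / lam ^ 3 * X₀s) / (4 / (ρ / x₀ / (Nr - 1) * L)) ^ 3 +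
      (1 / c) ^ 2 * ((Real.sqrt 2 * ℓ) ^ 2 * X₂s + 2 * (Av1 * ((Real.sqrt 2 * ℓ) * X₁s)) + Av2 * X₀s) / (4 / (ρ₃ / x₀ / (Nr - 1) * L)) ^ 2 +
      (1 / c) ^ 2 * ((Real.sqrt 2 * ℓ) ^ 3 * X₃s + 3 * (Av1 * ((Real.sqrt 2 * ℓ) ^ 2 * X₂s)) +
        3 * (Av2 * ((Real.sqrt 2 * ℓ) * X₁s)) + (κA + κB) * ℓ ^ 3 / lam ^ 3 * X₀s) / (4 / (ρ / x₀ / (Nr - 1) * L)) ^ 3) :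
    AΔs ≤ P / (c * Λ ^ 2) * (K1 + π ^ 3 * σ ^ 3 * 𝔗 +
      ρ ^ 3 / 64 * (((Real.sqrt 2 * (2 * π)) ^ 3 * 𝔛₃ + 3 * 𝔞e1 * (2 * (2 * π) ^ 2) * 𝔛₂ + 3 * 𝔞e2 * (Real.sqrt 2 * (2 * π)) * 𝔛₁ + κs * (2 * π) ^ 3 * K1) +
        ((Real.sqrt 2 * (5 * π)) ^ 3 * 𝔛₃ + 3 * 𝔞n1 * (2 * (5 * π) ^ 2) * 𝔛₂ + 3 * 𝔞n2 * (Real.sqrt 2 * (5 * π)) * 𝔛₁ + κs * (5 * π) ^ 3 * K1) +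
        ((Real.sqrt 2 * (5 * π)) ^ 3 * 𝔛₃ + 3 * 𝔞v1 * (2 * (5 * π) ^ 2) * 𝔛₂ + 3 * 𝔞v2 * (Real.sqrt 2 * (5 * π)) * 𝔛₁ + κs * (5 * π) ^ 3 * K1)) +
      ρ₃ ^ 2 / 16 * (2 * (5 * π) ^ 2 * 𝔛₂ + 2 * 𝔞v1 * (Real.sqrt 2 * (5 * π)) * 𝔛₁ + 𝔞v2 * K1)) := by
  have hπ := Real.pi_pos
  have hx₀0 : 0 < x₀ := lt_of_lt_of_le one_pos hx₀
  subst hNr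
  have hr2 : ρ / x₀ / ((2 : ℝ) - 1) = ρ / x₀ := by norm_num
  have hr3 : ρ₃ / x₀ / ((2 : ℝ) - 1) = ρ₃ / x₀ := by norm_num
  rw [hr2, hr3] at hAΔs
  have hℓ₁L : ℓ₁ * L = 2 * π := by rw [hℓ₁]; field_simp
  have hℓL : ℓ * L = 5 * π := by rw [hℓ]; field_simp; ring
  -- the six groups
  have g1 : (1 / c) ^ 2 * X₀s = P / (c * Λ ^ 2) * K1 := by rw [hX₀]; field_simp
  have g2 : Tts / (4 / (s₀ * P2M)) ^ 3 ≤ P / (c * Λ ^ 2) * (π ^ 3 * σ ^ 3 * 𝔗) := by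
    have hsP : 0 < s₀ * P2M := by positivity
    have e : Tts / (4 / (s₀ * P2M)) ^ 3 = Tts * (s₀ * P2M) ^ 3 / 64 := by field_simp; ring
    rw [e]
    have h3 : (s₀ * P2M) ^ 3 ≤ (2 * σ * Λ * β) ^ 3 := pow_le_pow_left₀ hsP.le hsM 3
    calc Tts * (s₀ * P2M) ^ 3 / 64 ≤ ((2 * π / β) ^ 3 * P * 𝔗 / (c * Λ ^ 5)) * (2 * σ * Λ * β) ^ 3 / 64 := by
          gcongr
      _ = P / (c * Λ ^ 2) * (π ^ 3 * σ ^ 3 * 𝔗) := by field_simp; ring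
  have g3 := covBlock3_le (θ := 2 * π) hc hΛ hlam hL hx₀ hlx hρ hP (by positivity) hℓ₁L hAe10 hAe20 h𝔞e1 h𝔞e2 hX₁0 hX₂0 h𝔛₁ h𝔛₂ hK1
    hX₀ hX₁ hX₂ hX₃ hκ
  have g4 := covBlock3_le (θ := 5 * π) hc hΛ hlam hL hx₀ hlx hρ hP (by positivity) hℓL hAn10 hAn20 h𝔞n1 h𝔞n2 hX₁0 hX₂0 h𝔛₁ h𝔛₂ hK1
    hX₀ hX₁ hX₂ hX₃ hκ
  have g5 := covBlock2_le (r := ρ₃) (θ := 5 * π) hc hΛ hlam hL hx₀ hlx hP (by positivity) hℓL hAv10 hAv20 h𝔞v1 h𝔞v2 hX₀0 hX₁0 h𝔛₁ hK1 hX₀ hX₁ hX₂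
  have g6 := covBlock3_le (θ := 5 * π) hc hΛ hlam hL hx₀ hlx hρ hP (by positivity) hℓL hAv10 hAv20 h𝔞v1 h𝔞v2 hX₁0 hX₂0 h𝔛₁ h𝔛₂ hK1
    hX₀ hX₁ hX₂ hX₃ hκ
  rw [hAΔs, g1]
  have htot := add_le_add (add_le_add (add_le_add (add_le_add (add_le_add (le_refl (P / (c * Λ ^ 2) * K1)) g2) g3) g4) g5) g6
  refine htot.trans (le_of_eq ?_)
  ring

end Summit.HubbardSuperconductivity.HubbardSuperconductivity.Theorems.TorusFourierL2

end
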